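import Summits.AtomisticToContinuum.Crystallization.Theorems.FrustratedLawDichotomyStrainedPatchSoftSplitA

/-!
# Strained patch — «SoftSplit», part B: §3 the record instance and §4 the route of record (F₆′) with both far T-leaves split (incl. the (α) T26 corollary)
(lens-5 g85 NODE «SoftSplit» v4 b69f86162b2d6362, 688 l, dedup edit = probes/DedupT26-85.lean 56abb292…; 3-way cut at §2‖§3 and §4‖§5 under the 400-line cap by
hand-2 g39 for landing: A = §0–§2, B = §3–§4, main = §5; bodies byte-verbatim, header/opens repeated; full module docstring in part A.) -/

noncomputable section

open scoped BigOperators Classical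
open Literature.Analysis.ValidatedNumerics.Numerics (SC)
open Summit.AtomisticToContinuum.Crystallization.Theorems.FrustratedLawDichotomyAperiodicGapRecordJunctionHomFloorF6pT26 (level_ok_fallback_A35000_T26)
open Summit.AtomisticToContinuum.Crystallization.Theorems.ChargedEnergyGapNegative (eStar E3)
open Summit.AtomisticToContinuum.Crystallization.Theorems.FrustratedLawDichotomyRangeCut
open Summit.AtomisticToContinuum.Crystallization.Theorems.FrustratedLawDichotomySchurCut
open Summit.AtomisticToContinuum.Crystallization.Theorems.FrustratedLawDichotomyMotifLemmas (GoodAtScale)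
open Summit.AtomisticToContinuum.Crystallization.Theorems.FrustratedLawDichotomyAveragingCut (ballAvg)
open Summit.AtomisticToContinuum.Crystallization.Theorems.FrustratedLawDichotomyExemptLocOpt (LocOptFails)
open Summit.AtomisticToContinuum.Crystallization.Theorems.FrustratedLawDichotomyExemptSplit (SchurElasticPricingX)
open Summit.AtomisticToContinuum.Crystallization.Theorems.FrustratedLawDichotomyExemptAbsorptionRecord
open Summit.AtomisticToContinuum.Crystallization.Theorems.FrustratedLawDichotomyCollarCensus
open Summit.AtomisticToContinuum.Crystallization.Theorems.FrustratedLawDichotomyCollarCensusKappa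
open Summit.AtomisticToContinuum.Crystallization.Theorems.FrustratedLawDichotomyStrainedPatchHomSplit
open Summit.AtomisticToContinuum.Crystallization.Theorems.FrustratedLawDichotomyStrainedPatchCleanCollar (CleanBall TailPenalty AnnularDefectFloor
  DefectiveCollarFloor tailOut)
open Summit.AtomisticToContinuum.Crystallization.Theorems.FrustratedLawDichotomyStrainedPatchPhaseCut (MonoPhaseBall AnnularPhaseFloor PolyTextureFloor
  monoPhaseBall_comp_iff FccGoodAtScale)
open Summit.AtomisticToContinuum.Crystallization.Theorems.FrustratedLawDichotomyStrainedPatchCoreTube (NearHomIsoAt CoreOffTubeFloor RimOffTubeFloor nearHomIsoAt_comp_iff)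
open Summit.AtomisticToContinuum.Crystallization.Theorems.FrustratedLawDichotomyStrainedPatchCoreTubeRecord (CoreCoreRelief)
open Summit.AtomisticToContinuum.Crystallization.Theorems.FrustratedLawDichotomyStrainedPatchStrainBands (EdgeFarFloor coreOff_iff_edge_and_soft
  softFarFloor_eighth)
open Summit.AtomisticToContinuum.Crystallization.Theorems.FrustratedLawDichotomyStrainedPatchHomIsometry (admissible_comp_iff goodAtScale_comp_iff
  dist_comp injective_comp_iff)
open Summit.AtomisticToContinuum.Crystallization.Theorems.FrustratedLawDichotomyStrainedPatchHomTubeIso (cleanBall_comp_iff ballAvg_xRec_comp)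
open Summit.AtomisticToContinuum.Crystallization.Theorems.FrustratedLawDichotomyStrainedPatchChartFamilies (ChartBy FamilyLE familyLE_refl
  ChartBy.mono_t ChartBy.mono_family)
open Summit.AtomisticToContinuum.Crystallization.Theorems.FrustratedLawDichotomyStrainedPatchHostCells (TubeFloor FamilyCover FamP)
open Summit.AtomisticToContinuum.Crystallization.Theorems.FrustratedLawDichotomyStrainedPatchQuantSlaving (ChartFam SlackTab)
open Summit.AtomisticToContinuum.Crystallization.Theorems.FrustratedLawDichotomyStrainedPatchGradedTube
open Summit.AtomisticToContinuum.Crystallization.Theorems.FrustratedLawDichotomyStrainedPatchCoverBridge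
open Summit.AtomisticToContinuum.Crystallization.Theorems.FrustratedLawDichotomyStrainedPatchPairTube
open Summit.AtomisticToContinuum.Crystallization.Theorems.FrustratedLawDichotomyStrainedPatchHomCertTree (CertTree treeOK)
open Summit.AtomisticToContinuum.Crystallization.Theorems.FrustratedLawDichotomyStrainedPatchHomEntryGram (rootC rootW)
open Summit.AtomisticToContinuum.Crystallization.Theorems.FrustratedLawDichotomyStrainedPatchHomEntryGramHcp (rootCH rootWH)
open Summit.AtomisticToContinuum.Crystallization.Theorems.FrustratedLawDichotomyStrainedPatchHomEntryLeafHT (entryLeafOK6RBKP4 semOKH)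
open Summit.AtomisticToContinuum.Crystallization.Theorems.FrustratedLawDichotomyAperiodicGapRecordJunctionHomFloorF6p
open Summit.AtomisticToContinuum.Crystallization.Theorems.FrustratedLawDichotomyAperiodicGapRecordJunctionHomFloorGraded

namespace Summit.AtomisticToContinuum.Crystallization.Theorems.FrustratedLawDichotomyStrainedPatchSoftSplit

/-! ## §3. The record instance: additive split of the record cone, [CORE-FAR] of record, route (F), and the crux BY NAME -/

section Record

variable {𝓘₀ 𝓘 : ChartFam} {𝓥 : ModeFam} {τ₁ τ₂ : ℝ} {β₁ β₂ s₁ s₂ βf sf : (M₀ : ℕ) → (Fin M₀ → E3) → Fin M₀ → ℝ}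

/-- ★ The record cone is ADDITIVE in `(β, s, τ₀)` branch by branch: two `relConeBy` tables with dominated parameter sums sum below the record table.
[formal bookkeeping] -/
theorem relConeBy_add_le {RE τ : ℝ} (hβ : ∀ (M₀ : ℕ) (z₀ : Fin M₀ → E3) (c₀ : Fin M₀), β₁ M₀ z₀ c₀ + β₂ M₀ z₀ c₀ ≤ βf M₀ z₀ c₀)
    (hs : ∀ (M₀ : ℕ) (z₀ : Fin M₀ → E3) (c₀ : Fin M₀), s₁ M₀ z₀ c₀ + s₂ M₀ z₀ c₀ ≤ sf M₀ z₀ c₀) (hτ : τ₁ + τ₂ ≤ τ)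
    (M₀ : ℕ) (z₀ : Fin M₀ → E3) (c₀ : Fin M₀) (a b : Fin M₀) :
    relConeBy RE β₁ s₁ τ₁ M₀ z₀ c₀ a b + relConeBy RE β₂ s₂ τ₂ M₀ z₀ c₀ a b ≤ relConeBy RE βf sf τ M₀ z₀ c₀ a b := by
  unfold relConeBy relCone
  by_cases hrel : dist (z₀ a) (z₀ b) ≤ 9 / 2 ∧ min (dist (z₀ a) (z₀ c₀)) (dist (z₀ b) (z₀ c₀)) ≤ RE
  · simp only [if_pos hrel]
    have hd : 0 ≤ dist (z₀ a) (z₀ b) := dist_nonneg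
    nlinarith [hβ M₀ z₀ c₀, mul_le_mul_of_nonneg_right (hs M₀ z₀ c₀) hd]
  · simp only [if_neg hrel]
    linarith

/-- Constant site tables add. [formal bookkeeping] -/
theorem constTol_add_le {τ : ℝ} (hτ : τ₁ + τ₂ ≤ τ) (M₀ : ℕ) (z₀ : Fin M₀ → E3) (c₀ : Fin M₀) (a : Fin M₀) :
    constTol τ₁ M₀ z₀ c₀ a + constTol τ₂ M₀ z₀ c₀ a ≤ constTol τ M₀ z₀ c₀ a := by
  simpa [constTol] using hτ

/-- ★★★ THE RECORD PAIR NODE (host-graded, any core radius): (T_rec) ∧ (S_rec) ∧ `τ₁ + τ₂ ≤ 1/25`, `β₁ + β₂ ≤ βf`, `s₁ + s₂ ≤ sf` ⟹ (D_GB⋆ by host at ρ, ε). -/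
theorem refineGBRecByAt_of_softSplit {ρ ε : ℝ}
    (hT : RefineGBS 𝓘₀ 𝓘 𝓥 ρ ε (1 / 8) (1 / 25) (constTol (1 / 25)) τ₁ (constTol τ₁) (relConeBy 2 β₁ s₁ τ₁))
    (hS : SoftEnvelope 𝓥 τ₂ (constTol τ₂) (relConeBy 2 β₂ s₂ τ₂)) (hτ : τ₁ + τ₂ ≤ 1 / 25)
    (hβ : ∀ (M₀ : ℕ) (z₀ : Fin M₀ → E3) (c₀ : Fin M₀), β₁ M₀ z₀ c₀ + β₂ M₀ z₀ c₀ ≤ βf M₀ z₀ c₀)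
    (hs : ∀ (M₀ : ℕ) (z₀ : Fin M₀ → E3) (c₀ : Fin M₀), s₁ M₀ z₀ c₀ + s₂ M₀ z₀ c₀ ≤ sf M₀ z₀ c₀) : RefineGBRecByAt 𝓘₀ 𝓘 ρ ε βf sf :=
  refineGB_of_refineGBS_of_softEnvelope hT hS hτ (constTol_add_le hτ) (relConeBy_add_le hβ hs hτ)

/-- ★★★ … at the record core `(24/5, 1/100)`: (D_GB⋆ by host). -/
theorem refineGBRecBy_of_softSplit
    (hT : RefineGBS 𝓘₀ 𝓘 𝓥 (24 / 5) (1 / 100) (1 / 8) (1 / 25) (constTol (1 / 25)) τ₁ (constTol τ₁) (relConeBy 2 β₁ s₁ τ₁))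
    (hS : SoftEnvelope 𝓥 τ₂ (constTol τ₂) (relConeBy 2 β₂ s₂ τ₂)) (hτ : τ₁ + τ₂ ≤ 1 / 25)
    (hβ : ∀ (M₀ : ℕ) (z₀ : Fin M₀ → E3) (c₀ : Fin M₀), β₁ M₀ z₀ c₀ + β₂ M₀ z₀ c₀ ≤ βf M₀ z₀ c₀)
    (hs : ∀ (M₀ : ℕ) (z₀ : Fin M₀ → E3) (c₀ : Fin M₀), s₁ M₀ z₀ c₀ + s₂ M₀ z₀ c₀ ≤ sf M₀ z₀ c₀) : RefineGBRecBy 𝓘₀ 𝓘 βf sf :=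
  refineGBRecByAt_of_softSplit hT hS hτ hβ hs

/-- ★★★ THE RECORD COVER NODE: (K_S,rec) ∧ (S_rec) ∧ `τ₁ + τ₂ ≤ 1/25` ⟹ (K⋆ at ρ, ε). -/
theorem familyCoverGRecAt_of_softSplit {ρ ε : ℝ} {B₂ : PairTab} (hK : FamilyCoverGS 𝓘₀ 𝓥 ρ ε (1 / 8) τ₁ (constTol τ₁))
    (hS : SoftEnvelope 𝓥 τ₂ (constTol τ₂) B₂) (hτ : τ₁ + τ₂ ≤ 1 / 25) : FamilyCoverGRecAt 𝓘₀ ρ ε :=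
  familyCoverG_of_familyCoverGS_of_softEnvelope hK hS hτ (constTol_add_le hτ)

/-- ★★★ … at the record core: (K⋆). -/
theorem familyCoverGRec_of_softSplit {B₂ : PairTab} (hK : FamilyCoverGS 𝓘₀ 𝓥 (24 / 5) (1 / 100) (1 / 8) τ₁ (constTol τ₁))
    (hS : SoftEnvelope 𝓥 τ₂ (constTol τ₂) B₂) (hτ : τ₁ + τ₂ ≤ 1 / 25) : FamilyCoverGRec 𝓘₀ :=
  familyCoverGRecAt_of_softSplit hK hS hτ

/-- ★ [CORE-FAR] T-leaf target of record from the three graded E-cells of record, the record cover and the SPLIT pair bridge. -/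
theorem coreOff_record_of_softSplit {ηP ηW : ℝ}
    (h₁ : TubeFloorGBRec (fun M₀ z₀ c₀ => 𝓘 M₀ z₀ c₀ ∧ lowLevel ηP M₀ z₀ c₀) (197 / 10000) (49 / 5000))
    (h₂ : TubeFloorGBRec (fun M₀ z₀ c₀ => (𝓘 M₀ z₀ c₀ ∧ ¬lowLevel ηP M₀ z₀ c₀) ∧ fccCentred ηW M₀ z₀ c₀) (131 / 10000) (131 / 20000))
    (h₃ : TubeFloorGBRec (fun M₀ z₀ c₀ => (𝓘 M₀ z₀ c₀ ∧ ¬lowLevel ηP M₀ z₀ c₀) ∧ ¬fccCentred ηW M₀ z₀ c₀) (239 / 10000) 0)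
    (hK : FamilyCoverGRec 𝓘₀)
    (hT : RefineGBS 𝓘₀ 𝓘 𝓥 (24 / 5) (1 / 100) (1 / 8) (1 / 25) (constTol (1 / 25)) τ₁ (constTol τ₁) (relConeBy 2 β₁ s₁ τ₁))
    (hS : SoftEnvelope 𝓥 τ₂ (constTol τ₂) (relConeBy 2 β₂ s₂ τ₂)) (hτ : τ₁ + τ₂ ≤ 1 / 25)
    (hβ : ∀ (M₀ : ℕ) (z₀ : Fin M₀ → E3) (c₀ : Fin M₀), β₁ M₀ z₀ c₀ + β₂ M₀ z₀ c₀ ≤ recordGradedBox ηP ηW M₀ z₀ c₀)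
    (hs : ∀ (M₀ : ℕ) (z₀ : Fin M₀ → E3) (c₀ : Fin M₀), s₁ M₀ z₀ c₀ + s₂ M₀ z₀ c₀ ≤ recordGradedSlope ηP ηW M₀ z₀ c₀) :
    CoreOffTubeFloor (63 / 10) (63 / 10) (24 / 5) (1 / 100) 0 :=
  coreOff_record_of_recordGraded h₁ h₂ h₃ hK (refineGBRecBy_of_softSplit hT hS hτ hβ hs)

/-- ★ Route (F), `ρ = 26/5`: the same E-cells (ρ-blind), the record cover and the SPLIT pair bridge at `26/5`. -/
theorem coreOff_26_5_of_softSplit {ηP ηW : ℝ}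
    (h₁ : TubeFloorGBRec (fun M₀ z₀ c₀ => 𝓘 M₀ z₀ c₀ ∧ lowLevel ηP M₀ z₀ c₀) (197 / 10000) (49 / 5000))
    (h₂ : TubeFloorGBRec (fun M₀ z₀ c₀ => (𝓘 M₀ z₀ c₀ ∧ ¬lowLevel ηP M₀ z₀ c₀) ∧ fccCentred ηW M₀ z₀ c₀) (131 / 10000) (131 / 20000))
    (h₃ : TubeFloorGBRec (fun M₀ z₀ c₀ => (𝓘 M₀ z₀ c₀ ∧ ¬lowLevel ηP M₀ z₀ c₀) ∧ ¬fccCentred ηW M₀ z₀ c₀) (239 / 10000) 0)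
    (hK : FamilyCoverGRecAt 𝓘₀ (26 / 5) (1 / 100))
    (hT : RefineGBS 𝓘₀ 𝓘 𝓥 (26 / 5) (1 / 100) (1 / 8) (1 / 25) (constTol (1 / 25)) τ₁ (constTol τ₁) (relConeBy 2 β₁ s₁ τ₁))
    (hS : SoftEnvelope 𝓥 τ₂ (constTol τ₂) (relConeBy 2 β₂ s₂ τ₂)) (hτ : τ₁ + τ₂ ≤ 1 / 25)
    (hβ : ∀ (M₀ : ℕ) (z₀ : Fin M₀ → E3) (c₀ : Fin M₀), β₁ M₀ z₀ c₀ + β₂ M₀ z₀ c₀ ≤ recordGradedBox ηP ηW M₀ z₀ c₀)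
    (hs : ∀ (M₀ : ℕ) (z₀ : Fin M₀ → E3) (c₀ : Fin M₀), s₁ M₀ z₀ c₀ + s₂ M₀ z₀ c₀ ≤ recordGradedSlope ηP ηW M₀ z₀ c₀) :
    CoreOffTubeFloor (63 / 10) (63 / 10) (26 / 5) (1 / 100) 0 :=
  coreOff_26_5_of_recordGraded h₁ h₂ h₃ hK (refineGBRecByAt_of_softSplit hT hS hτ hβ hs)

/-- ★★★ THE CRUX BY NAME through the landed graded junction `aperiodicFrustratedLawGap_of_homFloor_625_of_recordGraded` (…PairTubeRecordGraded, p854011),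
with its pair bridge `hDG` supplied by the SPLIT (T_rec) ∧ (S_rec) ∧ sums — every other hypothesis verbatim. -/
theorem aperiodicFrustratedLawGap_of_homFloor_625_of_softSplit {εE CE DE DX ηP ηW : ℝ}
    (hε0 : 0 < εE) (hε1 : εE ≤ 1 / 10000) (hU : PeriodicEnergyCeiling (-(7175 / 10000))) (hDX : 0 ≤ DX)
    (hE : SchurElasticPricingX (1 / 20) (1 / 8) w₄₅ ω₄ (3 / 400) (-(7175 / 10000)) (1 / 10000) CE DE DX (LocOptFails eStar εE (3 / 2) 1))
    (hHF : HomFloor (1 / 625)) (hTP : TailPenalty (24 / 5) (1 / 1000)) (hRl : CoreCoreRelief (63 / 10) (63 / 10) (24 / 5) (1 / 100) (3 / 5000))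
    (h₁ : TubeFloorGBRec (fun M₀ z₀ c₀ => 𝓘 M₀ z₀ c₀ ∧ lowLevel ηP M₀ z₀ c₀) (197 / 10000) (49 / 5000))
    (h₂ : TubeFloorGBRec (fun M₀ z₀ c₀ => (𝓘 M₀ z₀ c₀ ∧ ¬lowLevel ηP M₀ z₀ c₀) ∧ fccCentred ηW M₀ z₀ c₀) (131 / 10000) (131 / 20000))
    (h₃ : TubeFloorGBRec (fun M₀ z₀ c₀ => (𝓘 M₀ z₀ c₀ ∧ ¬lowLevel ηP M₀ z₀ c₀) ∧ ¬fccCentred ηW M₀ z₀ c₀) (239 / 10000) 0)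
    (hK : FamilyCoverGRec 𝓘₀)
    (hT : RefineGBS 𝓘₀ 𝓘 𝓥 (24 / 5) (1 / 100) (1 / 8) (1 / 25) (constTol (1 / 25)) τ₁ (constTol τ₁) (relConeBy 2 β₁ s₁ τ₁))
    (hS : SoftEnvelope 𝓥 τ₂ (constTol τ₂) (relConeBy 2 β₂ s₂ τ₂)) (hτ : τ₁ + τ₂ ≤ 1 / 25)
    (hβ : ∀ (M₀ : ℕ) (z₀ : Fin M₀ → E3) (c₀ : Fin M₀), β₁ M₀ z₀ c₀ + β₂ M₀ z₀ c₀ ≤ recordGradedBox ηP ηW M₀ z₀ c₀)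
    (hs : ∀ (M₀ : ℕ) (z₀ : Fin M₀ → E3) (c₀ : Fin M₀), s₁ M₀ z₀ c₀ + s₂ M₀ z₀ c₀ ≤ recordGradedSlope ηP ηW M₀ z₀ c₀)
    (hF : AnnularPhaseFloor (63 / 10) (24 / 5) (63 / 10) (1 / 1000))
    (hP : PolyTextureFloor (63 / 10) (24 / 5) (1 / 1000)) (hA : AnnularDefectFloor (24 / 5) (63 / 10)) (hD : DefectiveCollarFloor (24 / 5))
    (h2 : CrowdedCoreMotifPricingCapK (1 / 1000) (9 / 5) (133 / 10) (3 / 2) (effPot w₄₅ ω₄ (3 / 400)) (-(7175 / 10000) + 3 / 400)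
      (Collar (9 / 2) fun N y j => (∃ s : ℝ, 0 ≤ s ∧ s ≤ 3 / 2 ∧ NonEquilibriumCore (-(7175 / 10000)) 0 7 s (1 / 10000) N y j) ∨
        GoodAtScale (1 / 20) (3 / 2) y j))
    (h3 : DiluteDefectMotifPricingCapK (1 / 1000) (9 / 5) (133 / 10) (3 / 2) (effPot w₄₅ ω₄ (3 / 400)) (-(7175 / 10000) + 3 / 400)
      (Collar (9 / 2) fun N y j => (∃ s : ℝ, 0 ≤ s ∧ s ≤ 3 / 2 ∧ NonEquilibriumCore (-(7175 / 10000)) 0 7 s (1 / 10000) N y j) ∨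
        GoodAtScale (1 / 20) (3 / 2) y j)) :
    Summit.AtomisticToContinuum.Crystallization.Theses.FrustratedLawDichotomy.AperiodicFrustratedLawGap :=
  aperiodicFrustratedLawGap_of_homFloor_625_of_recordGraded hε0 hε1 hU hDX hE hHF hTP hRl h₁ h₂ h₃ hK
    (refineGBRecBy_of_softSplit hT hS hτ hβ hs) hF hP hA hD h2 h3

end Record


/-! ## §4. The ROUTE OF RECORD (F₆′) (`…AperiodicGapRecordJunctionHomFloorGraded`, p854038) with BOTH far T-leaves split: RIM + [CORE-FAR] at `26/5`, crux BY NAME -/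

section RecordF6p

variable {𝓘₀ 𝓘 : ChartFam} {𝓥 : ModeFam} {τK τ₁ τ₂ : ℝ} {β₁ β₂ s₁ s₂ : (M₀ : ℕ) → (Fin M₀ → E3) → Fin M₀ → ℝ}

/-- ★ THE RIM `(24/5, 1/100) → (26/5, 1/100)` of (F₆′) from the three graded E-cells of record and the SPLIT `26/5` cover (K_S) ∧ SPLIT `26/5` pair bridge (T)
∧ ONE soft envelope (S) ∧ the two budget sums (`τK + τ₂ ≤ 1/25` for the cover, `τ₁ + τ₂ ≤ 1/25` and the cone sums for the bridge). [formal bookkeeping: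
`rim_26_5_of_recordGraded` at `familyCoverGRecAt_of_softSplit`, `refineGBRecByAt_of_softSplit`] -/
theorem rim_26_5_of_softSplit {ηP ηW : ℝ}
    (h₁ : TubeFloorGBRec (fun M₀ z₀ c₀ => 𝓘 M₀ z₀ c₀ ∧ lowLevel ηP M₀ z₀ c₀) (197 / 10000) (49 / 5000))
    (h₂ : TubeFloorGBRec (fun M₀ z₀ c₀ => (𝓘 M₀ z₀ c₀ ∧ ¬lowLevel ηP M₀ z₀ c₀) ∧ fccCentred ηW M₀ z₀ c₀) (131 / 10000) (131 / 20000))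
    (h₃ : TubeFloorGBRec (fun M₀ z₀ c₀ => (𝓘 M₀ z₀ c₀ ∧ ¬lowLevel ηP M₀ z₀ c₀) ∧ ¬fccCentred ηW M₀ z₀ c₀) (239 / 10000) 0)
    (hK : FamilyCoverGS 𝓘₀ 𝓥 (26 / 5) (1 / 100) (1 / 8) τK (constTol τK))
    (hT : RefineGBS 𝓘₀ 𝓘 𝓥 (26 / 5) (1 / 100) (1 / 8) (1 / 25) (constTol (1 / 25)) τ₁ (constTol τ₁) (relConeBy 2 β₁ s₁ τ₁))
    (hS : SoftEnvelope 𝓥 τ₂ (constTol τ₂) (relConeBy 2 β₂ s₂ τ₂)) (hτK : τK + τ₂ ≤ 1 / 25) (hτ : τ₁ + τ₂ ≤ 1 / 25)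
    (hβ : ∀ (M₀ : ℕ) (z₀ : Fin M₀ → E3) (c₀ : Fin M₀), β₁ M₀ z₀ c₀ + β₂ M₀ z₀ c₀ ≤ recordGradedBox ηP ηW M₀ z₀ c₀)
    (hs : ∀ (M₀ : ℕ) (z₀ : Fin M₀ → E3) (c₀ : Fin M₀), s₁ M₀ z₀ c₀ + s₂ M₀ z₀ c₀ ≤ recordGradedSlope ηP ηW M₀ z₀ c₀) :
    RimOffTubeFloor (63 / 10) (63 / 10) (24 / 5) (1 / 100) (26 / 5) (1 / 100) 0 :=
  rim_26_5_of_recordGraded h₁ h₂ h₃ (familyCoverGRecAt_of_softSplit hK hS hτK) (refineGBRecByAt_of_softSplit hT hS hτ hβ hs)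

/-- ★ … and the record [CORE-FAR] at `24/5` from the same split `26/5` leaves. [formal bookkeeping] -/
theorem coreOff_record_of_softSplit_at_26_5 {ηP ηW : ℝ}
    (h₁ : TubeFloorGBRec (fun M₀ z₀ c₀ => 𝓘 M₀ z₀ c₀ ∧ lowLevel ηP M₀ z₀ c₀) (197 / 10000) (49 / 5000))
    (h₂ : TubeFloorGBRec (fun M₀ z₀ c₀ => (𝓘 M₀ z₀ c₀ ∧ ¬lowLevel ηP M₀ z₀ c₀) ∧ fccCentred ηW M₀ z₀ c₀) (131 / 10000) (131 / 20000))
    (h₃ : TubeFloorGBRec (fun M₀ z₀ c₀ => (𝓘 M₀ z₀ c₀ ∧ ¬lowLevel ηP M₀ z₀ c₀) ∧ ¬fccCentred ηW M₀ z₀ c₀) (239 / 10000) 0)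
    (hK : FamilyCoverGS 𝓘₀ 𝓥 (26 / 5) (1 / 100) (1 / 8) τK (constTol τK))
    (hT : RefineGBS 𝓘₀ 𝓘 𝓥 (26 / 5) (1 / 100) (1 / 8) (1 / 25) (constTol (1 / 25)) τ₁ (constTol τ₁) (relConeBy 2 β₁ s₁ τ₁))
    (hS : SoftEnvelope 𝓥 τ₂ (constTol τ₂) (relConeBy 2 β₂ s₂ τ₂)) (hτK : τK + τ₂ ≤ 1 / 25) (hτ : τ₁ + τ₂ ≤ 1 / 25)
    (hβ : ∀ (M₀ : ℕ) (z₀ : Fin M₀ → E3) (c₀ : Fin M₀), β₁ M₀ z₀ c₀ + β₂ M₀ z₀ c₀ ≤ recordGradedBox ηP ηW M₀ z₀ c₀)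
    (hs : ∀ (M₀ : ℕ) (z₀ : Fin M₀ → E3) (c₀ : Fin M₀), s₁ M₀ z₀ c₀ + s₂ M₀ z₀ c₀ ≤ recordGradedSlope ηP ηW M₀ z₀ c₀) :
    CoreOffTubeFloor (63 / 10) (63 / 10) (24 / 5) (1 / 100) 0 :=
  coreOff_record_of_recordGraded_at_26_5 h₁ h₂ h₃ (familyCoverGRecAt_of_softSplit hK hS hτK) (refineGBRecByAt_of_softSplit hT hS hτ hβ hs)

/-- ★★★ **THE CRUX BY NAME ON THE ROUTE OF RECORD (F₆′) WITH BOTH INSTANCES OF RECORD** (H: fcc v4 ∃-tree + hcp semantic root fact at `μ₇₈`; T-far: the three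
graded E-cells) — through `aperiodicFrustratedLawGap_of_entryTree6RBKP4_semOKH_fallbackLever_recordGraded_A35000_T22_record` (p854038) with its two analytic
far T-leaves `hK : FamilyCoverGRecAt 𝓘₀ (26/5) (1/100)` and `hD : RefineGBRecByAt 𝓘₀ 𝓘 (26/5) (1/100) (recordGradedBox ηP ηW) (recordGradedSlope ηP ηW)` REPLACED by
the split leaves (K_S) `hK`, (T) `hT`, the ONE soft envelope (S) `hS` and the budget sums; every other hypothesis verbatim. -/
theorem aperiodicFrustratedLawGap_of_entryTree6RBKP4_semOKH_fallbackLever_softSplit_A35000_T22_record {εE CE DE DX ηP ηW : ℝ}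
    (hε0 : 0 < εE) (hε1 : εE ≤ 1 / 10000) (hDX : 0 ≤ DX)
    (hE : SchurElasticPricingX (1 / 20) (1 / 8) w₄₅ ω₄ (3 / 400) (-(7175 / 10000)) (1 / 10000) CE DE DX (LocOptFails eStar εE (3 / 2) 1))
    (hFcc : ∃ t : CertTree (Fin 3 × Fin 3), treeOK (entryLeafOK6RBKP4 (-399232847967326)) t rootC rootW = true)
    (hHcp : semOKH (-399232847967326) rootCH rootWH = true)
    (hTl : ∀ (M : ℕ) (z : Fin M → E3) (c : Fin M), Admissible M z c → CleanBall (63 / 10) z c → MonoPhaseBall (63 / 10) z c →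
      NearHomIsoAt (26 / 5) (1 / 100) z c → -(11 / 50000) ≤ ballAvg (9 / 5) z (tailOut (26 / 5) M z c) c)
    (hR : CoreCoreRelief (63 / 10) (63 / 10) (26 / 5) (1 / 100) (3 / 5000))
    (h₁ : TubeFloorGBRec (fun M₀ z₀ c₀ => 𝓘 M₀ z₀ c₀ ∧ lowLevel ηP M₀ z₀ c₀) (197 / 10000) (49 / 5000))
    (h₂ : TubeFloorGBRec (fun M₀ z₀ c₀ => (𝓘 M₀ z₀ c₀ ∧ ¬lowLevel ηP M₀ z₀ c₀) ∧ fccCentred ηW M₀ z₀ c₀) (131 / 10000) (131 / 20000))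
    (h₃ : TubeFloorGBRec (fun M₀ z₀ c₀ => (𝓘 M₀ z₀ c₀ ∧ ¬lowLevel ηP M₀ z₀ c₀) ∧ ¬fccCentred ηW M₀ z₀ c₀) (239 / 10000) 0)
    (hK : FamilyCoverGS 𝓘₀ 𝓥 (26 / 5) (1 / 100) (1 / 8) τK (constTol τK))
    (hT : RefineGBS 𝓘₀ 𝓘 𝓥 (26 / 5) (1 / 100) (1 / 8) (1 / 25) (constTol (1 / 25)) τ₁ (constTol τ₁) (relConeBy 2 β₁ s₁ τ₁))
    (hS : SoftEnvelope 𝓥 τ₂ (constTol τ₂) (relConeBy 2 β₂ s₂ τ₂)) (hτK : τK + τ₂ ≤ 1 / 25) (hτ : τ₁ + τ₂ ≤ 1 / 25)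
    (hβ : ∀ (M₀ : ℕ) (z₀ : Fin M₀ → E3) (c₀ : Fin M₀), β₁ M₀ z₀ c₀ + β₂ M₀ z₀ c₀ ≤ recordGradedBox ηP ηW M₀ z₀ c₀)
    (hs : ∀ (M₀ : ℕ) (z₀ : Fin M₀ → E3) (c₀ : Fin M₀), s₁ M₀ z₀ c₀ + s₂ M₀ z₀ c₀ ≤ recordGradedSlope ηP ηW M₀ z₀ c₀)
    (hF : AnnularPhaseFloor (63 / 10) (24 / 5) (63 / 10) (1 / 1000)) (hP : PolyTextureFloor (63 / 10) (24 / 5) (1 / 1000))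
    (hA : AnnularDefectFloor (24 / 5) (63 / 10)) (hDC : DefectiveCollarFloor (24 / 5))
    (h2 : CrowdedCoreMotifPricingCapK (1 / 1000) (9 / 5) (133 / 10) (3 / 2) (effPot w₄₅ ω₄ (3 / 400)) (-(7175 / 10000) + 3 / 400)
      (Collar (9 / 2) fun N y j => (∃ s : ℝ, 0 ≤ s ∧ s ≤ 3 / 2 ∧ NonEquilibriumCore (-(7175 / 10000)) 0 7 s (1 / 10000) N y j) ∨
        GoodAtScale (1 / 20) (3 / 2) y j))
    (h3 : DiluteDefectMotifPricingCapK (1 / 1000) (9 / 5) (133 / 10) (3 / 2) (effPot w₄₅ ω₄ (3 / 400)) (-(7175 / 10000) + 3 / 400)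
      (Collar (9 / 2) fun N y j => (∃ s : ℝ, 0 ≤ s ∧ s ≤ 3 / 2 ∧ NonEquilibriumCore (-(7175 / 10000)) 0 7 s (1 / 10000) N y j) ∨
        GoodAtScale (1 / 20) (3 / 2) y j)) :
    Summit.AtomisticToContinuum.Crystallization.Theses.FrustratedLawDichotomy.AperiodicFrustratedLawGap :=
  aperiodicFrustratedLawGap_of_entryTree6RBKP4_semOKH_fallbackLever_recordGraded_A35000_T22_record hε0 hε1 hDX hE hFcc hHcp hTl hR h₁ h₂ h₃
    (familyCoverGRecAt_of_softSplit hK hS hτK) (refineGBRecByAt_of_softSplit hT hS hτ hβ hs) hF hP hA hDC h2 h3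

/-- ★★ The same over the BARE homogeneous floor `HomFloor (3/5000 + 11/50000)` (any H-currency, via `…HomFloorF6p` §1). -/
theorem aperiodicFrustratedLawGap_of_homFloor_fallbackLever_softSplit_A35000_T22_record {εE CE DE DX ηP ηW : ℝ}
    (hε0 : 0 < εE) (hε1 : εE ≤ 1 / 10000) (hDX : 0 ≤ DX)
    (hE : SchurElasticPricingX (1 / 20) (1 / 8) w₄₅ ω₄ (3 / 400) (-(7175 / 10000)) (1 / 10000) CE DE DX (LocOptFails eStar εE (3 / 2) 1))
    (hH : HomFloor (3 / 5000 + 11 / 50000))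
    (hTl : ∀ (M : ℕ) (z : Fin M → E3) (c : Fin M), Admissible M z c → CleanBall (63 / 10) z c → MonoPhaseBall (63 / 10) z c →
      NearHomIsoAt (26 / 5) (1 / 100) z c → -(11 / 50000) ≤ ballAvg (9 / 5) z (tailOut (26 / 5) M z c) c)
    (hR : CoreCoreRelief (63 / 10) (63 / 10) (26 / 5) (1 / 100) (3 / 5000))
    (h₁ : TubeFloorGBRec (fun M₀ z₀ c₀ => 𝓘 M₀ z₀ c₀ ∧ lowLevel ηP M₀ z₀ c₀) (197 / 10000) (49 / 5000))
    (h₂ : TubeFloorGBRec (fun M₀ z₀ c₀ => (𝓘 M₀ z₀ c₀ ∧ ¬lowLevel ηP M₀ z₀ c₀) ∧ fccCentred ηW M₀ z₀ c₀) (131 / 10000) (131 / 20000))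
    (h₃ : TubeFloorGBRec (fun M₀ z₀ c₀ => (𝓘 M₀ z₀ c₀ ∧ ¬lowLevel ηP M₀ z₀ c₀) ∧ ¬fccCentred ηW M₀ z₀ c₀) (239 / 10000) 0)
    (hK : FamilyCoverGS 𝓘₀ 𝓥 (26 / 5) (1 / 100) (1 / 8) τK (constTol τK))
    (hT : RefineGBS 𝓘₀ 𝓘 𝓥 (26 / 5) (1 / 100) (1 / 8) (1 / 25) (constTol (1 / 25)) τ₁ (constTol τ₁) (relConeBy 2 β₁ s₁ τ₁))
    (hS : SoftEnvelope 𝓥 τ₂ (constTol τ₂) (relConeBy 2 β₂ s₂ τ₂)) (hτK : τK + τ₂ ≤ 1 / 25) (hτ : τ₁ + τ₂ ≤ 1 / 25)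
    (hβ : ∀ (M₀ : ℕ) (z₀ : Fin M₀ → E3) (c₀ : Fin M₀), β₁ M₀ z₀ c₀ + β₂ M₀ z₀ c₀ ≤ recordGradedBox ηP ηW M₀ z₀ c₀)
    (hs : ∀ (M₀ : ℕ) (z₀ : Fin M₀ → E3) (c₀ : Fin M₀), s₁ M₀ z₀ c₀ + s₂ M₀ z₀ c₀ ≤ recordGradedSlope ηP ηW M₀ z₀ c₀)
    (hF : AnnularPhaseFloor (63 / 10) (24 / 5) (63 / 10) (1 / 1000)) (hP : PolyTextureFloor (63 / 10) (24 / 5) (1 / 1000))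
    (hA : AnnularDefectFloor (24 / 5) (63 / 10)) (hDC : DefectiveCollarFloor (24 / 5))
    (h2 : CrowdedCoreMotifPricingCapK (1 / 1000) (9 / 5) (133 / 10) (3 / 2) (effPot w₄₅ ω₄ (3 / 400)) (-(7175 / 10000) + 3 / 400)
      (Collar (9 / 2) fun N y j => (∃ s : ℝ, 0 ≤ s ∧ s ≤ 3 / 2 ∧ NonEquilibriumCore (-(7175 / 10000)) 0 7 s (1 / 10000) N y j) ∨
        GoodAtScale (1 / 20) (3 / 2) y j))
    (h3 : DiluteDefectMotifPricingCapK (1 / 1000) (9 / 5) (133 / 10) (3 / 2) (effPot w₄₅ ω₄ (3 / 400)) (-(7175 / 10000) + 3 / 400)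
      (Collar (9 / 2) fun N y j => (∃ s : ℝ, 0 ≤ s ∧ s ≤ 3 / 2 ∧ NonEquilibriumCore (-(7175 / 10000)) 0 7 s (1 / 10000) N y j) ∨
        GoodAtScale (1 / 20) (3 / 2) y j)) :
    Summit.AtomisticToContinuum.Crystallization.Theses.FrustratedLawDichotomy.AperiodicFrustratedLawGap :=
  aperiodicFrustratedLawGap_of_homFloor_fallbackLever_recordGraded_A35000_T22_record hε0 hε1 hDX hE hH hTl hR h₁ h₂ h₃
    (familyCoverGRecAt_of_softSplit hK hS hτK) (refineGBRecByAt_of_softSplit hT hS hτ hβ hs) hF hP hA hDC h2 h3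

/-- ★★★ **LITERAL-GENERIC FORM (any tail allowance `μT`, relief `A`, floor `m ≥ A + μT`, level `μ` with `2 (m + e_W) SC ≤ μ`)** of the crux by name on (F₆′) at
`(ρ′, ε′) = (26/5, 1/100)` with BOTH far T-leaves split — through the level-generic interface `…_semOKH_level_of_coreOffRecord_of_rim_tubeTail` (…HomFloorF6p §2).
The (α)-switch of census TAIL12 (μT 11/50000 ↦ 13/50000, μ₇₈ ↦ μ₇₄) or any later dial is an INSTANTIATION of this theorem; no retyping on the T-far side. -/
theorem aperiodicFrustratedLawGap_of_entryTree6RBKP4_semOKH_level_of_softSplit_26_5_tubeTail {μ : ℤ} {m μT A εE CE DE DX ηP ηW : ℝ}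
    (hε0 : 0 < εE) (hε1 : εE ≤ 1 / 10000) (hDX : 0 ≤ DX)
    (hE : SchurElasticPricingX (1 / 20) (1 / 8) w₄₅ ω₄ (3 / 400) (-(7175 / 10000)) (1 / 10000) CE DE DX (LocOptFails eStar εE (3 / 2) 1))
    (hμ : 2 * (m + (-(7175 / 10000) + 3 / 400)) * SC ≤ μ)
    (hFcc : ∃ t : CertTree (Fin 3 × Fin 3), treeOK (entryLeafOK6RBKP4 μ) t rootC rootW = true)
    (hHcp : semOKH μ rootCH rootWH = true)
    (hTl : ∀ (M : ℕ) (z : Fin M → E3) (c : Fin M), Admissible M z c → CleanBall (63 / 10) z c → MonoPhaseBall (63 / 10) z c →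
      NearHomIsoAt (26 / 5) (1 / 100) z c → -μT ≤ ballAvg (9 / 5) z (tailOut (26 / 5) M z c) c)
    (hR : CoreCoreRelief (63 / 10) (63 / 10) (26 / 5) (1 / 100) A) (hm : A + μT ≤ m)
    (h₁ : TubeFloorGBRec (fun M₀ z₀ c₀ => 𝓘 M₀ z₀ c₀ ∧ lowLevel ηP M₀ z₀ c₀) (197 / 10000) (49 / 5000))
    (h₂ : TubeFloorGBRec (fun M₀ z₀ c₀ => (𝓘 M₀ z₀ c₀ ∧ ¬lowLevel ηP M₀ z₀ c₀) ∧ fccCentred ηW M₀ z₀ c₀) (131 / 10000) (131 / 20000))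
    (h₃ : TubeFloorGBRec (fun M₀ z₀ c₀ => (𝓘 M₀ z₀ c₀ ∧ ¬lowLevel ηP M₀ z₀ c₀) ∧ ¬fccCentred ηW M₀ z₀ c₀) (239 / 10000) 0)
    (hK : FamilyCoverGS 𝓘₀ 𝓥 (26 / 5) (1 / 100) (1 / 8) τK (constTol τK))
    (hT : RefineGBS 𝓘₀ 𝓘 𝓥 (26 / 5) (1 / 100) (1 / 8) (1 / 25) (constTol (1 / 25)) τ₁ (constTol τ₁) (relConeBy 2 β₁ s₁ τ₁))
    (hS : SoftEnvelope 𝓥 τ₂ (constTol τ₂) (relConeBy 2 β₂ s₂ τ₂)) (hτK : τK + τ₂ ≤ 1 / 25) (hτ : τ₁ + τ₂ ≤ 1 / 25)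
    (hβ : ∀ (M₀ : ℕ) (z₀ : Fin M₀ → E3) (c₀ : Fin M₀), β₁ M₀ z₀ c₀ + β₂ M₀ z₀ c₀ ≤ recordGradedBox ηP ηW M₀ z₀ c₀)
    (hs : ∀ (M₀ : ℕ) (z₀ : Fin M₀ → E3) (c₀ : Fin M₀), s₁ M₀ z₀ c₀ + s₂ M₀ z₀ c₀ ≤ recordGradedSlope ηP ηW M₀ z₀ c₀)
    (hF : AnnularPhaseFloor (63 / 10) (24 / 5) (63 / 10) (1 / 1000)) (hP : PolyTextureFloor (63 / 10) (24 / 5) (1 / 1000))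
    (hA : AnnularDefectFloor (24 / 5) (63 / 10)) (hDC : DefectiveCollarFloor (24 / 5))
    (h2 : CrowdedCoreMotifPricingCapK (1 / 1000) (9 / 5) (133 / 10) (3 / 2) (effPot w₄₅ ω₄ (3 / 400)) (-(7175 / 10000) + 3 / 400)
      (Collar (9 / 2) fun N y j => (∃ s : ℝ, 0 ≤ s ∧ s ≤ 3 / 2 ∧ NonEquilibriumCore (-(7175 / 10000)) 0 7 s (1 / 10000) N y j) ∨
        GoodAtScale (1 / 20) (3 / 2) y j))
    (h3 : DiluteDefectMotifPricingCapK (1 / 1000) (9 / 5) (133 / 10) (3 / 2) (effPot w₄₅ ω₄ (3 / 400)) (-(7175 / 10000) + 3 / 400)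
      (Collar (9 / 2) fun N y j => (∃ s : ℝ, 0 ≤ s ∧ s ≤ 3 / 2 ∧ NonEquilibriumCore (-(7175 / 10000)) 0 7 s (1 / 10000) N y j) ∨
        GoodAtScale (1 / 20) (3 / 2) y j)) :
    Summit.AtomisticToContinuum.Crystallization.Theses.FrustratedLawDichotomy.AperiodicFrustratedLawGap :=
  aperiodicFrustratedLawGap_of_entryTree6RBKP4_semOKH_level_of_coreOffRecord_of_rim_tubeTail hε0 hε1 hDX hE hμ hFcc hHcp (by norm_num) (by norm_num)
    hTl hR hm (coreOff_record_of_softSplit_at_26_5 h₁ h₂ h₃ hK hT hS hτK hτ hβ hs) (rim_26_5_of_softSplit h₁ h₂ h₃ hK hT hS hτK hτ hβ hs)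
    hF hP (by norm_num) (by norm_num) hA hDC h2 h3

/-- ★★ The same over a BARE homogeneous floor `HomFloor m` (any H-currency), literal-generic in `(m, μT, A)`. -/
theorem aperiodicFrustratedLawGap_of_homFloor_level_of_softSplit_26_5_tubeTail {m μT A εE CE DE DX ηP ηW : ℝ}
    (hε0 : 0 < εE) (hε1 : εE ≤ 1 / 10000) (hDX : 0 ≤ DX)
    (hE : SchurElasticPricingX (1 / 20) (1 / 8) w₄₅ ω₄ (3 / 400) (-(7175 / 10000)) (1 / 10000) CE DE DX (LocOptFails eStar εE (3 / 2) 1))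
    (hH : HomFloor m)
    (hTl : ∀ (M : ℕ) (z : Fin M → E3) (c : Fin M), Admissible M z c → CleanBall (63 / 10) z c → MonoPhaseBall (63 / 10) z c →
      NearHomIsoAt (26 / 5) (1 / 100) z c → -μT ≤ ballAvg (9 / 5) z (tailOut (26 / 5) M z c) c)
    (hR : CoreCoreRelief (63 / 10) (63 / 10) (26 / 5) (1 / 100) A) (hm : A + μT ≤ m)
    (h₁ : TubeFloorGBRec (fun M₀ z₀ c₀ => 𝓘 M₀ z₀ c₀ ∧ lowLevel ηP M₀ z₀ c₀) (197 / 10000) (49 / 5000))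
    (h₂ : TubeFloorGBRec (fun M₀ z₀ c₀ => (𝓘 M₀ z₀ c₀ ∧ ¬lowLevel ηP M₀ z₀ c₀) ∧ fccCentred ηW M₀ z₀ c₀) (131 / 10000) (131 / 20000))
    (h₃ : TubeFloorGBRec (fun M₀ z₀ c₀ => (𝓘 M₀ z₀ c₀ ∧ ¬lowLevel ηP M₀ z₀ c₀) ∧ ¬fccCentred ηW M₀ z₀ c₀) (239 / 10000) 0)
    (hK : FamilyCoverGS 𝓘₀ 𝓥 (26 / 5) (1 / 100) (1 / 8) τK (constTol τK))
    (hT : RefineGBS 𝓘₀ 𝓘 𝓥 (26 / 5) (1 / 100) (1 / 8) (1 / 25) (constTol (1 / 25)) τ₁ (constTol τ₁) (relConeBy 2 β₁ s₁ τ₁))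
    (hS : SoftEnvelope 𝓥 τ₂ (constTol τ₂) (relConeBy 2 β₂ s₂ τ₂)) (hτK : τK + τ₂ ≤ 1 / 25) (hτ : τ₁ + τ₂ ≤ 1 / 25)
    (hβ : ∀ (M₀ : ℕ) (z₀ : Fin M₀ → E3) (c₀ : Fin M₀), β₁ M₀ z₀ c₀ + β₂ M₀ z₀ c₀ ≤ recordGradedBox ηP ηW M₀ z₀ c₀)
    (hs : ∀ (M₀ : ℕ) (z₀ : Fin M₀ → E3) (c₀ : Fin M₀), s₁ M₀ z₀ c₀ + s₂ M₀ z₀ c₀ ≤ recordGradedSlope ηP ηW M₀ z₀ c₀)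
    (hF : AnnularPhaseFloor (63 / 10) (24 / 5) (63 / 10) (1 / 1000)) (hP : PolyTextureFloor (63 / 10) (24 / 5) (1 / 1000))
    (hA : AnnularDefectFloor (24 / 5) (63 / 10)) (hDC : DefectiveCollarFloor (24 / 5))
    (h2 : CrowdedCoreMotifPricingCapK (1 / 1000) (9 / 5) (133 / 10) (3 / 2) (effPot w₄₅ ω₄ (3 / 400)) (-(7175 / 10000) + 3 / 400)
      (Collar (9 / 2) fun N y j => (∃ s : ℝ, 0 ≤ s ∧ s ≤ 3 / 2 ∧ NonEquilibriumCore (-(7175 / 10000)) 0 7 s (1 / 10000) N y j) ∨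
        GoodAtScale (1 / 20) (3 / 2) y j))
    (h3 : DiluteDefectMotifPricingCapK (1 / 1000) (9 / 5) (133 / 10) (3 / 2) (effPot w₄₅ ω₄ (3 / 400)) (-(7175 / 10000) + 3 / 400)
      (Collar (9 / 2) fun N y j => (∃ s : ℝ, 0 ≤ s ∧ s ≤ 3 / 2 ∧ NonEquilibriumCore (-(7175 / 10000)) 0 7 s (1 / 10000) N y j) ∨
        GoodAtScale (1 / 20) (3 / 2) y j)) :
    Summit.AtomisticToContinuum.Crystallization.Theses.FrustratedLawDichotomy.AperiodicFrustratedLawGap :=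
  aperiodicFrustratedLawGap_of_homFloor_level_of_coreOffRecord_of_rim_tubeTail hε0 hε1 hDX hE hH (by norm_num) (by norm_num)
    hTl hR hm (coreOff_record_of_softSplit_at_26_5 h₁ h₂ h₃ hK hT hS hτK hτ hβ hs) (rim_26_5_of_softSplit h₁ h₂ h₃ hK hT hS hτK hτ hβ hs)
    hF hP (by norm_num) (by norm_num) hA hDC h2 h3


/-- ★★★ **(F₆′) AFTER THE (α) SWITCH** (`A = 3/5000`, `μT = 13/50000`, level `μ₇₄`) with BOTH far T-leaves split — an INSTANTIATION of
`…_semOKH_level_of_softSplit_26_5_tubeTail`; shows the T-far side needs no retyping under the switch. -/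
theorem aperiodicFrustratedLawGap_of_entryTree6RBKP4_semOKH_fallbackLever_softSplit_A35000_T26_record {εE CE DE DX ηP ηW : ℝ}
    (hε0 : 0 < εE) (hε1 : εE ≤ 1 / 10000) (hDX : 0 ≤ DX)
    (hE : SchurElasticPricingX (1 / 20) (1 / 8) w₄₅ ω₄ (3 / 400) (-(7175 / 10000)) (1 / 10000) CE DE DX (LocOptFails eStar εE (3 / 2) 1))
    (hFcc : ∃ t : CertTree (Fin 3 × Fin 3), treeOK (entryLeafOK6RBKP4 (-399210329969189)) t rootC rootW = true)
    (hHcp : semOKH (-399210329969189) rootCH rootWH = true)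
    (hTl : ∀ (M : ℕ) (z : Fin M → E3) (c : Fin M), Admissible M z c → CleanBall (63 / 10) z c → MonoPhaseBall (63 / 10) z c →
      NearHomIsoAt (26 / 5) (1 / 100) z c → -(13 / 50000) ≤ ballAvg (9 / 5) z (tailOut (26 / 5) M z c) c)
    (hR : CoreCoreRelief (63 / 10) (63 / 10) (26 / 5) (1 / 100) (3 / 5000))
    (h₁ : TubeFloorGBRec (fun M₀ z₀ c₀ => 𝓘 M₀ z₀ c₀ ∧ lowLevel ηP M₀ z₀ c₀) (197 / 10000) (49 / 5000))
    (h₂ : TubeFloorGBRec (fun M₀ z₀ c₀ => (𝓘 M₀ z₀ c₀ ∧ ¬lowLevel ηP M₀ z₀ c₀) ∧ fccCentred ηW M₀ z₀ c₀) (131 / 10000) (131 / 20000))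
    (h₃ : TubeFloorGBRec (fun M₀ z₀ c₀ => (𝓘 M₀ z₀ c₀ ∧ ¬lowLevel ηP M₀ z₀ c₀) ∧ ¬fccCentred ηW M₀ z₀ c₀) (239 / 10000) 0)
    (hK : FamilyCoverGS 𝓘₀ 𝓥 (26 / 5) (1 / 100) (1 / 8) τK (constTol τK))
    (hT : RefineGBS 𝓘₀ 𝓘 𝓥 (26 / 5) (1 / 100) (1 / 8) (1 / 25) (constTol (1 / 25)) τ₁ (constTol τ₁) (relConeBy 2 β₁ s₁ τ₁))
    (hS : SoftEnvelope 𝓥 τ₂ (constTol τ₂) (relConeBy 2 β₂ s₂ τ₂)) (hτK : τK + τ₂ ≤ 1 / 25) (hτ : τ₁ + τ₂ ≤ 1 / 25)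
    (hβ : ∀ (M₀ : ℕ) (z₀ : Fin M₀ → E3) (c₀ : Fin M₀), β₁ M₀ z₀ c₀ + β₂ M₀ z₀ c₀ ≤ recordGradedBox ηP ηW M₀ z₀ c₀)
    (hs : ∀ (M₀ : ℕ) (z₀ : Fin M₀ → E3) (c₀ : Fin M₀), s₁ M₀ z₀ c₀ + s₂ M₀ z₀ c₀ ≤ recordGradedSlope ηP ηW M₀ z₀ c₀)
    (hF : AnnularPhaseFloor (63 / 10) (24 / 5) (63 / 10) (1 / 1000)) (hP : PolyTextureFloor (63 / 10) (24 / 5) (1 / 1000))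
    (hA : AnnularDefectFloor (24 / 5) (63 / 10)) (hDC : DefectiveCollarFloor (24 / 5))
    (h2 : CrowdedCoreMotifPricingCapK (1 / 1000) (9 / 5) (133 / 10) (3 / 2) (effPot w₄₅ ω₄ (3 / 400)) (-(7175 / 10000) + 3 / 400)
      (Collar (9 / 2) fun N y j => (∃ s : ℝ, 0 ≤ s ∧ s ≤ 3 / 2 ∧ NonEquilibriumCore (-(7175 / 10000)) 0 7 s (1 / 10000) N y j) ∨
        GoodAtScale (1 / 20) (3 / 2) y j))
    (h3 : DiluteDefectMotifPricingCapK (1 / 1000) (9 / 5) (133 / 10) (3 / 2) (effPot w₄₅ ω₄ (3 / 400)) (-(7175 / 10000) + 3 / 400)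
      (Collar (9 / 2) fun N y j => (∃ s : ℝ, 0 ≤ s ∧ s ≤ 3 / 2 ∧ NonEquilibriumCore (-(7175 / 10000)) 0 7 s (1 / 10000) N y j) ∨
        GoodAtScale (1 / 20) (3 / 2) y j)) :
    Summit.AtomisticToContinuum.Crystallization.Theses.FrustratedLawDichotomy.AperiodicFrustratedLawGap :=
  aperiodicFrustratedLawGap_of_entryTree6RBKP4_semOKH_level_of_softSplit_26_5_tubeTail (m := 3 / 5000 + 13 / 50000) hε0 hε1 hDX hE
    level_ok_fallback_A35000_T26 hFcc hHcp hTl hR le_rfl h₁ h₂ h₃ hK hT hS hτK hτ hβ hs hF hP hA hDC h2 h3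

end RecordF6p



end Summit.AtomisticToContinuum.Crystallization.Theorems.FrustratedLawDichotomyStrainedPatchSoftSplit

end
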